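import Mathlib
import Literature.Analysis.FluidPDE.VectorCalculus
import Literature.Analysis.FluidPDE.VectorCalculusProofs
import Literature.Analysis.FluidPDE.TaoEnstrophyLocalisation
import Summits.NavierStokesRegularity.NavierStokesRegularity.Theorems.SlicedKelvinPlanarFluxAPrioriSqrtReg

/-!
# Crux `SlicedKelvin.PlanarFluxAPriori` (stmt-NavierStokesRegularity-15600), line `registered`:
  the POINTWISE ε-fold law (helper for the stub `stub_epsFoldLaw`)

The registered stub `stub_epsFoldLaw` of the skeleton `Cruxes/PlanarFluxAPriori/Lines/birth.lean`
(rev 2) asserts the frame-covariant ε-fold law `Theorems.SlicedKelvin.EpsFoldLawOn ν ε c R v` (an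
identity between plane integrals) for smooth divergence-free fields with cubic decay. Its
kinematic heart is a POINTWISE identity on `ℝ³`, proved here as `foldLaw_pointwise` (registered
sub-goal). In the orthonormal frame `{e₀ = R e₀, e₁ = R e₁, n = R e₂}`, with `ω = curl v`,
`f = ⟪ω, n⟫`, `F(s) = √(s² + ε²)` (`F' = s/F`, `F'' = ε²/F³`, `F² = s² + ε²`, `ε > 0`) and the
vorticity tendency `w = νΔω − (v·∇)ω + (ω·∇)v` (right-hand side of the vorticity equation):

  `F'(f) ⟪w, n⟫ = ν ∂ₙ∂ₙ(F∘f) − ν F''(f) |∇f|² − ⟪v,n⟫ F''(f) (⟪ω,e₀⟫ ∂₀f + ⟪ω,e₁⟫ ∂₁f)`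
  `               − ε² ∂ₙ⟪v,n⟫ / F(f) + ∂₀X₀ + ∂₁X₁`,
  `Xᵢ = ν ∂ᵢ(F∘f) − ⟪v,eᵢ⟫ F(f) + F'(f) ⟪v,n⟫ ⟪ω,eᵢ⟫`   (`i = 0, 1`, `∂ₑ = D·[e]`).

Derivation (`n` constant): `⟪w,n⟫ = νΔf − Df[v] + D⟪v,n⟫[ω]`;
(i) `ν F'(f) Δf = ν Σᵢ ∂ᵢ∂ᵢ(F∘f) − ν F''(f) |∇f|²`;
(ii) `−F'(f) Df[v] = −Σᵢ vᵢ ∂ᵢ(F∘f) = −Σ_{i<2} ∂ᵢ(vᵢ F∘f) − (∂ₙvₙ) F(f) − vₙ ∂ₙ(F∘f)`, by `div v = 0`;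
(iii) `F'(f) D⟪v,n⟫[ω] = Σ_{i<2} ∂ᵢ(F'(f) vₙ ωᵢ) − vₙ F''(f) Σ_{i<2} ωᵢ ∂ᵢf + F'(f) vₙ ∂ₙf + f F'(f) ∂ₙvₙ`,
by `div ω = 0` (`divergence_curl_eq_zero_holds`); the `vₙ ∂ₙ(F∘f)` terms cancel and
`∂ₙvₙ (f F'(f) − F(f)) = −ε² ∂ₙvₙ / F(f)`.

Contents:
* `F_ε`-calculus on top of the landed `…PlanarFluxAPrioriSqrtReg` (positivity, `ε ≤ F`, `F'`,
  `F''`, chain rule) and `…EpsilonLimit` (`|s| ≤ F ≤ |s| + ε`): `F² = s² + ε²`, smoothness of `F`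
  and `s/F`, and the bounded factors `|f/F(f)| ≤ 1`, `ε²/F(f)³ ≤ ε⁻¹`, `F(f) ≤ sup |f| + ε` used
  by the integrability bookkeeping of the stub file;
* first- and second-order chain rules: components `⟪g, n⟫`, `F∘f`, `f/F(f)`, `∂ₑf`, `∂_{e'}∂ₑ(F∘f)`
  (`fderiv_fderiv_sqrtReg_comp_apply`), and the Leibniz expansion of `∂_{e'}Xₑ`
  (`fderiv_foldFlux_apply`);
* `foldLaw_pointwise`: the identity above, its four main terms written verbatim as the integrands
  of `EpsFoldLawOn` (the stub file only integrates it over the plane). After expanding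
  `⟪Δω,n⟫ = Σᵢ D²f[bᵢ,bᵢ]`, `⟪Dω(v),n⟫`, `⟪Dv(ω),n⟫` in the frame `b = (R e₀, R e₁, R e₂)` and every
  derivative by the lemmas above, and substituting `div v = 0`, `div ω = 0`, `ε² = F² − f²`, the
  remaining rational identity is closed by `field_simp; ring`.

Mathlib + `Literature.Analysis.FluidPDE.{VectorCalculus, VectorCalculusProofs,
TaoEnstrophyLocalisation}` (`curl = curlCLM ∘ D`) + the landed `…PlanarFluxAPrioriSqrtReg`.
-/

noncomputable section

-- Problem = summit for this single-conjunct summit: the duplicate namespace component is deliberate.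
set_option linter.dupNamespace false

namespace Summit.NavierStokesRegularity.NavierStokesRegularity.Theorems.SlicedKelvinPlanarFluxAPriori

open Literature.Analysis.FluidPDE
open scoped InnerProductSpace RealInnerProductSpace ContDiff

/-! ### The regularised absolute value `F_ε(s) = √(s² + ε²)`

Positivity, `ε ≤ F_ε`, `|s| ≤ F_ε`, the derivatives `F_ε' = s/F_ε`, `F_ε'' = ε²/F_ε³` and the chain
rule `D(F_ε∘φ) = F_ε'(φ) • Dφ` are the landed `sqrt_sq_add_sq_pos`, `le_sqrt_sq_add_sq`,
`abs_le_sqrt_sq_add_sq`, `hasDerivAt_sqrt_sq_add_sq`, `hasDerivAt_div_sqrt_sq_add_sq`,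
`hasFDerivAt_sqrtReg` of `…PlanarFluxAPrioriSqrtReg` / `…EpsilonLimit` (imported, not restated). -/

/-- `F_ε(s)² = s² + ε²`. -/
theorem sqrtReg_sq (s ε : ℝ) : Real.sqrt (s ^ 2 + ε ^ 2) ^ 2 = s ^ 2 + ε ^ 2 :=
  Real.sq_sqrt (by positivity)

/-- `F_ε` is smooth for `ε > 0`. -/
theorem contDiff_sqrtReg {ε : ℝ} (hε : 0 < ε) :
    ContDiff ℝ ∞ (fun s : ℝ => Real.sqrt (s ^ 2 + ε ^ 2)) :=
  ((contDiff_id.pow 2).add contDiff_const).sqrt fun s => ne_of_gt (by positivity)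

/-- `s ↦ s / F_ε(s)` is smooth for `ε > 0`. -/
theorem contDiff_div_sqrtReg {ε : ℝ} (hε : 0 < ε) :
    ContDiff ℝ ∞ (fun s : ℝ => s / Real.sqrt (s ^ 2 + ε ^ 2)) :=
  contDiff_id.div (contDiff_sqrtReg hε) fun s => (sqrt_sq_add_sq_pos hε s).ne'

/-- `|F_ε'(f x)| = |f x / F_ε(f x)| ≤ 1`: the regularised sign is bounded by one (landed
`abs_div_sqrt_sq_add_sq_le_one` of `…PlanarFluxAPrioriSqrtReg`). -/
theorem bdd_div_sqrtReg_comp (ε : ℝ) (f : EuclideanSpace ℝ (Fin 3) → ℝ) :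
    ∃ B : ℝ, ∀ x, ‖f x / Real.sqrt (f x ^ 2 + ε ^ 2)‖ ≤ B :=
  ⟨1, fun x => (Real.norm_eq_abs _).trans_le (abs_div_sqrt_sq_add_sq_le_one (f x) ε)⟩

/-- `F_ε''(f x) = ε² / F_ε(f x)³ ≤ ε⁻¹` is bounded (landed `sq_div_sqrt_cube_le`). -/
theorem bdd_sq_div_sqrtReg_comp_cube {ε : ℝ} (hε : 0 < ε) (f : EuclideanSpace ℝ (Fin 3) → ℝ) :
    ∃ B : ℝ, ∀ x, ‖ε ^ 2 / Real.sqrt (f x ^ 2 + ε ^ 2) ^ 3‖ ≤ B :=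
  ⟨ε⁻¹, fun x => by
    rw [Real.norm_eq_abs, abs_of_nonneg (sq_div_sqrt_cube_nonneg (f x) ε)]
    exact sq_div_sqrt_cube_le hε (f x)⟩

/-- `F_ε(f x) ≤ |f x| + ε` is bounded when `f` is (via the landed
`sqrt_sq_add_sq_sub_le_abs` of `…EpsilonLimit`). -/
theorem bdd_sqrtReg_comp {ε : ℝ} (hε : 0 ≤ ε) {f : EuclideanSpace ℝ (Fin 3) → ℝ}
    (hf : ∃ B : ℝ, ∀ x, ‖f x‖ ≤ B) : ∃ B : ℝ, ∀ x, ‖Real.sqrt (f x ^ 2 + ε ^ 2)‖ ≤ B := by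
  obtain ⟨B, hB⟩ := hf
  refine ⟨B + ε, fun x => ?_⟩
  rw [Real.norm_eq_abs, abs_of_nonneg (Real.sqrt_nonneg _)]
  have h1 := sqrt_sq_add_sq_sub_le_abs (f x) hε
  have h2 := (Real.norm_eq_abs _).symm.trans_le (hB x)
  linarith

/-! ### First-order calculus: components and `F_ε ∘ f` -/

/-- Derivative of a component `z ↦ ⟪g z, n⟫` along a fixed vector `n`: `h ↦ ⟪n, Dg(x) h⟫`. -/
theorem hasFDerivAt_inner_const {g : EuclideanSpace ℝ (Fin 3) → EuclideanSpace ℝ (Fin 3)}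
    {g' : EuclideanSpace ℝ (Fin 3) →L[ℝ] EuclideanSpace ℝ (Fin 3)} {x : EuclideanSpace ℝ (Fin 3)}
    (hg : HasFDerivAt g g' x) (n : EuclideanSpace ℝ (Fin 3)) :
    HasFDerivAt (fun z => ⟪g z, n⟫) ((innerSL ℝ n).comp g') x := by
  have h : (fun z => ⟪g z, n⟫) = fun z => innerSL ℝ n (g z) := by
    funext z
    rw [innerSL_apply_apply, real_inner_comm]
  rw [h]
  exact (innerSL ℝ n).hasFDerivAt.comp x hg

/-- `D⟪g, n⟫(x)[e] = ⟪n, Dg(x) e⟫`. -/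
theorem fderiv_inner_const_apply {g : EuclideanSpace ℝ (Fin 3) → EuclideanSpace ℝ (Fin 3)}
    {x : EuclideanSpace ℝ (Fin 3)} (hg : DifferentiableAt ℝ g x) (n e : EuclideanSpace ℝ (Fin 3)) :
    fderiv ℝ (fun z => ⟪g z, n⟫) x e = ⟪n, fderiv ℝ g x e⟫ := by
  rw [(hasFDerivAt_inner_const hg.hasFDerivAt n).fderiv]
  rfl

/-- Components of a `Cᵏ` field are `Cᵏ`. -/
theorem contDiff_inner_const {k : WithTop ℕ∞}
    {g : EuclideanSpace ℝ (Fin 3) → EuclideanSpace ℝ (Fin 3)} (hg : ContDiff ℝ k g)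
    (n : EuclideanSpace ℝ (Fin 3)) : ContDiff ℝ k (fun z => ⟪g z, n⟫) :=
  hg.inner ℝ contDiff_const

/-- `D(F_ε ∘ f)(x)[e] = (f x / F_ε(f x)) · Df(x)[e]`. -/
theorem fderiv_sqrtReg_comp_apply {ε : ℝ} (hε : 0 < ε) {f : EuclideanSpace ℝ (Fin 3) → ℝ}
    {x : EuclideanSpace ℝ (Fin 3)} (hf : DifferentiableAt ℝ f x) (e : EuclideanSpace ℝ (Fin 3)) :
    fderiv ℝ (fun z => Real.sqrt (f z ^ 2 + ε ^ 2)) x e =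
      f x / Real.sqrt (f x ^ 2 + ε ^ 2) * fderiv ℝ f x e := by
  rw [(hasFDerivAt_sqrtReg hε hf.hasFDerivAt).fderiv]
  rfl

/-- Chain rule for `F_ε' ∘ f = f / F_ε(f)`: `D(f/F_ε(f))(x) = (ε²/F_ε(f x)³) • Df(x)`. -/
theorem hasFDerivAt_div_sqrtReg_comp {ε : ℝ} (hε : 0 < ε) {f : EuclideanSpace ℝ (Fin 3) → ℝ}
    {f' : EuclideanSpace ℝ (Fin 3) →L[ℝ] ℝ} {x : EuclideanSpace ℝ (Fin 3)} (hf : HasFDerivAt f f' x) :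
    HasFDerivAt (fun z => f z / Real.sqrt (f z ^ 2 + ε ^ 2))
      ((ε ^ 2 / Real.sqrt (f x ^ 2 + ε ^ 2) ^ 3) • f') x :=
  (hasDerivAt_div_sqrt_sq_add_sq hε (f x)).comp_hasFDerivAt x hf

/-! ### Second-order calculus -/

/-- For `f ∈ C²`, `z ↦ Df(z)[e]` has derivative `h ↦ D²f(x)[h][e]`. -/
theorem hasFDerivAt_fderiv_apply_const {f : EuclideanSpace ℝ (Fin 3) → ℝ} (hf : ContDiff ℝ 2 f)
    (x e : EuclideanSpace ℝ (Fin 3)) :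
    HasFDerivAt (fun z => fderiv ℝ f z e)
      ((ContinuousLinearMap.apply ℝ ℝ e).comp (fderiv ℝ (fderiv ℝ f) x)) x := by
  have h1 : ContDiff ℝ 1 (fderiv ℝ f) := hf.fderiv_right (m := 1) (by norm_num)
  have h2 : HasFDerivAt (fderiv ℝ f) (fderiv ℝ (fderiv ℝ f) x) x :=
    (h1.differentiable one_ne_zero x).hasFDerivAt
  exact (ContinuousLinearMap.apply ℝ ℝ e).hasFDerivAt.comp x h2

/-- **Second derivatives of `F_ε ∘ f`.** For `f ∈ C²` and `ε > 0`,
`∂_{e'} ∂_e (F_ε ∘ f)(x) = F_ε''(f x) ∂_{e'}f ∂_e f + F_ε'(f x) ∂_{e'}∂_e f`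
with `F_ε' = f/F_ε`, `F_ε'' = ε²/F_ε³`. -/
theorem fderiv_fderiv_sqrtReg_comp_apply {ε : ℝ} (hε : 0 < ε) {f : EuclideanSpace ℝ (Fin 3) → ℝ}
    (hf : ContDiff ℝ 2 f) (x e e' : EuclideanSpace ℝ (Fin 3)) :
    fderiv ℝ (fun z => fderiv ℝ (fun x => Real.sqrt (f x ^ 2 + ε ^ 2)) z e) x e' =
      ε ^ 2 / Real.sqrt (f x ^ 2 + ε ^ 2) ^ 3 * fderiv ℝ f x e' * fderiv ℝ f x e +
        f x / Real.sqrt (f x ^ 2 + ε ^ 2) * fderiv ℝ (fderiv ℝ f) x e' e := by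
  have hd : Differentiable ℝ f := hf.differentiable (by norm_num)
  have hfun : (fun z => fderiv ℝ (fun x => Real.sqrt (f x ^ 2 + ε ^ 2)) z e) =
      fun z => f z / Real.sqrt (f z ^ 2 + ε ^ 2) * fderiv ℝ f z e := by
    funext z
    exact fderiv_sqrtReg_comp_apply hε (hd z) e
  rw [hfun, ((hasFDerivAt_div_sqrtReg_comp hε (hd x).hasFDerivAt).fun_mul
    (hasFDerivAt_fderiv_apply_const hf x e)).fderiv]
  simp only [add_apply, smul_apply, smul_eq_mul, ContinuousLinearMap.comp_apply,
    ContinuousLinearMap.apply_apply]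
  ring

/-! ### The in-plane flux field `X` and its derivative -/

/-- **Derivative of the in-plane flux component.** For `C²` fields `v, g` (`g` plays the
vorticity), a direction `e`, the normal `n` and `ε > 0`, the scalar field
`X(z) = ν ∂_e(F_ε ∘ f)(z) − ⟪v z, e⟫ F_ε(f z) + F_ε'(f z) ⟪v z, n⟫ ⟪g z, e⟫`, `f = ⟪g, n⟫`,
has directional derivative along `e'` given by the Leibniz/chain rules term by term. -/
theorem fderiv_foldFlux_apply {ε : ℝ} (hε : 0 < ε) (ν : ℝ)
    {v g : EuclideanSpace ℝ (Fin 3) → EuclideanSpace ℝ (Fin 3)}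
    (hv : ContDiff ℝ 2 v) (hg : ContDiff ℝ 2 g) (n e e' x : EuclideanSpace ℝ (Fin 3)) :
    fderiv ℝ (fun z => ν * fderiv ℝ (fun x => Real.sqrt (⟪g x, n⟫ ^ 2 + ε ^ 2)) z e -
        ⟪v z, e⟫ * Real.sqrt (⟪g z, n⟫ ^ 2 + ε ^ 2) +
        ⟪g z, n⟫ / Real.sqrt (⟪g z, n⟫ ^ 2 + ε ^ 2) * ⟪v z, n⟫ * ⟪g z, e⟫) x e' =
      ν * (ε ^ 2 / Real.sqrt (⟪g x, n⟫ ^ 2 + ε ^ 2) ^ 3 * ⟪n, fderiv ℝ g x e'⟫ *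
          ⟪n, fderiv ℝ g x e⟫ +
        ⟪g x, n⟫ / Real.sqrt (⟪g x, n⟫ ^ 2 + ε ^ 2) *
          fderiv ℝ (fderiv ℝ (fun z => ⟪g z, n⟫)) x e' e) -
      (⟪e, fderiv ℝ v x e'⟫ * Real.sqrt (⟪g x, n⟫ ^ 2 + ε ^ 2) +
        ⟪v x, e⟫ * (⟪g x, n⟫ / Real.sqrt (⟪g x, n⟫ ^ 2 + ε ^ 2) * ⟪n, fderiv ℝ g x e'⟫)) +
      (ε ^ 2 / Real.sqrt (⟪g x, n⟫ ^ 2 + ε ^ 2) ^ 3 * ⟪n, fderiv ℝ g x e'⟫ * ⟪v x, n⟫ * ⟪g x, e⟫ +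
        ⟪g x, n⟫ / Real.sqrt (⟪g x, n⟫ ^ 2 + ε ^ 2) * ⟪n, fderiv ℝ v x e'⟫ * ⟪g x, e⟫ +
        ⟪g x, n⟫ / Real.sqrt (⟪g x, n⟫ ^ 2 + ε ^ 2) * ⟪v x, n⟫ * ⟪e, fderiv ℝ g x e'⟫) := by
  -- the component `f = ⟪g, n⟫` and its derivatives
  have hf : ContDiff ℝ 2 (fun z => ⟪g z, n⟫) := contDiff_inner_const hg n
  have hgd : Differentiable ℝ g := hg.differentiable (by norm_num)
  have hvd : Differentiable ℝ v := hv.differentiable (by norm_num)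
  have hfD : ∀ z, HasFDerivAt (fun z => ⟪g z, n⟫) ((innerSL ℝ n).comp (fderiv ℝ g z)) z :=
    fun z => hasFDerivAt_inner_const (hgd z).hasFDerivAt n
  have hfd : ∀ z, DifferentiableAt ℝ (fun z => ⟪g z, n⟫) z := fun z => (hfD z).differentiableAt
  have hfderiv : ∀ z w, fderiv ℝ (fun z => ⟪g z, n⟫) z w = ⟪n, fderiv ℝ g z w⟫ :=
    fun z w => fderiv_inner_const_apply (hgd z) n w
  -- the first summand `ν ∂_e (F ∘ f)` is rewritten by the first-order chain rule under the binder
  have hXfun : (fun z => ν * fderiv ℝ (fun x => Real.sqrt (⟪g x, n⟫ ^ 2 + ε ^ 2)) z e -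
        ⟪v z, e⟫ * Real.sqrt (⟪g z, n⟫ ^ 2 + ε ^ 2) +
        ⟪g z, n⟫ / Real.sqrt (⟪g z, n⟫ ^ 2 + ε ^ 2) * ⟪v z, n⟫ * ⟪g z, e⟫) =
      fun z => ν * (⟪g z, n⟫ / Real.sqrt (⟪g z, n⟫ ^ 2 + ε ^ 2) *
          fderiv ℝ (fun z => ⟪g z, n⟫) z e) -
        ⟪v z, e⟫ * Real.sqrt (⟪g z, n⟫ ^ 2 + ε ^ 2) +
        ⟪g z, n⟫ / Real.sqrt (⟪g z, n⟫ ^ 2 + ε ^ 2) * ⟪v z, n⟫ * ⟪g z, e⟫ := by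
    funext z
    rw [fderiv_sqrtReg_comp_apply hε (hfd z) e]
  have hq : HasFDerivAt (fun z => ⟪g z, n⟫ / Real.sqrt (⟪g z, n⟫ ^ 2 + ε ^ 2))
      ((ε ^ 2 / Real.sqrt (⟪g x, n⟫ ^ 2 + ε ^ 2) ^ 3) • (innerSL ℝ n).comp (fderiv ℝ g x)) x :=
    hasFDerivAt_div_sqrtReg_comp hε (hfD x)
  have hr := hasFDerivAt_fderiv_apply_const hf x e
  have hG : HasFDerivAt (fun z => Real.sqrt (⟪g z, n⟫ ^ 2 + ε ^ 2))
      ((⟪g x, n⟫ / Real.sqrt (⟪g x, n⟫ ^ 2 + ε ^ 2)) • (innerSL ℝ n).comp (fderiv ℝ g x)) x :=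
    hasFDerivAt_sqrtReg hε (hfD x)
  have hve : HasFDerivAt (fun z => ⟪v z, e⟫) ((innerSL ℝ e).comp (fderiv ℝ v x)) x :=
    hasFDerivAt_inner_const (hvd x).hasFDerivAt e
  have hvn : HasFDerivAt (fun z => ⟪v z, n⟫) ((innerSL ℝ n).comp (fderiv ℝ v x)) x :=
    hasFDerivAt_inner_const (hvd x).hasFDerivAt n
  have hge : HasFDerivAt (fun z => ⟪g z, e⟫) ((innerSL ℝ e).comp (fderiv ℝ g x)) x :=
    hasFDerivAt_inner_const (hgd x).hasFDerivAt e
  rw [hXfun, ((((hq.fun_mul hr).const_mul ν).fun_sub (hve.fun_mul hG)).fun_add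
    ((hq.fun_mul hvn).fun_mul hge)).fderiv]
  simp only [add_apply, sub_apply, smul_apply, smul_eq_mul, ContinuousLinearMap.comp_apply,
    ContinuousLinearMap.apply_apply, innerSL_apply_apply, hfderiv]
  ring

/-! ### The pointwise ε-fold law -/

/-- **The POINTWISE ε-fold law** (registered sub-goal `foldLaw_pointwise` of `stub_epsFoldLaw`).
In the frame `R` (normal `n = R e₂`, in-plane `e₀ = R e₀`, `e₁ = R e₁`), for a smooth
divergence-free `v` with `ω = curl v`, `f = ⟪ω, n⟫`, `F(s) = √(s² + ε²)` (`ε > 0`) and the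
vorticity tendency `w = νΔω − (v·∇)ω + (ω·∇)v`, at every point `x`:
`F'(f)⟪w, n⟫ = ν ∂_n∂_n(F∘f) − ν F''(f)|∇f|² − ⟪v,n⟫ F''(f) (ω_∥·∇_∥ f) − ε² ∂_n⟪v,n⟫/F(f) + ∂₀X₀ + ∂₁X₁`,
`Xᵢ = ν ∂ᵢ(F∘f) − ⟪v,eᵢ⟫ F(f) + F'(f)⟪v,n⟫⟪ω,eᵢ⟫`, `F' = f/F`, `F'' = ε²/F³`. The first four
terms are, verbatim, the integrands of `Theorems.SlicedKelvin.EpsFoldLawOn`; the last two are the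
in-plane divergence that integrates to zero over every plane `R{x₂ = c}`. Proof: expand
`⟪Δω,n⟫ = Δf = Σᵢ ∂ᵢ²f`, `⟪Dω(v),n⟫ = Σᵢ vᵢ ∂ᵢf`, `⟪Dv(ω),n⟫ = Σᵢ ωᵢ ∂ᵢv_n` in the orthonormal
frame `{Re₀, Re₁, Re₂}`, the derivatives of `F∘f` and `Xᵢ` by the chain/Leibniz rules, use
`div v = 0`, `div ω = 0` (`divergence_curl_eq_zero_holds`) in that frame and `F² = f² + ε²`;
what is left is a rational identity (`field_simp; ring`). -/
theorem foldLaw_pointwise : ∀ (ν ε : ℝ), 0 < ε → ∀ (R : EuclideanSpace ℝ (Fin 3) ≃ₗᵢ[ℝ] EuclideanSpace ℝ (Fin 3)) (v : EuclideanSpace ℝ (Fin 3) → EuclideanSpace ℝ (Fin 3)), ContDiff ℝ (⊤ : ℕ∞) v → Literature.Analysis.FluidPDE.VectorCalculus.IsDivFree v → ∀ (x : EuclideanSpace ℝ (Fin 3)), inner ℝ (Literature.Analysis.FluidPDE.curl v x) (R (EuclideanSpace.single 2 1)) / Real.sqrt (inner ℝ (Literature.Analysis.FluidPDE.curl v x)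 (R (EuclideanSpace.single 2 1)) ^ 2 + ε ^ 2) * inner ℝ (ν • Laplacian.laplacian (Literature.Analysis.FluidPDE.curl v) x - Literature.Analysis.FluidPDE.convect v (Literature.Analysis.FluidPDE.curl v) x + Literature.Analysis.FluidPDE.convect (Literature.Analysis.FluidPDE.curl v) v x) (R (EuclideanSpace.single 2 1)) = ν * fderiv ℝ (fun z => fderiv ℝ (fun x => Real.sqrt (inner ℝ (Literature.Analysis.FluidPDE.curl v x) (R (EuclideanSpace.single 2 1)) ^ 2 + ε ^ 2)) z (R (EuclideanSpace.single 2 1))) x (R (EuclideanSpace.single 2 1)) - ν * (ε ^ 2 / Real.sqrt (inner ℝ (Literature.Analysis.FluidPDE.curl v x) (R (EuclideanSpace.single 2 1)) ^ 2 + ε ^ 2) ^ 3 * (fderiv ℝ (fun x => inner ℝ (Literature.Analysis.FluidPDE.curl v x) (R (EuclideanSpace.single 2 1))) x (R (EuclideanSpace.single 0 1)) ^ 2 + fderiv ℝ (fun x => inner ℝ (Literature.Analysis.FluidPDE.curl v x) (R (EuclideanSpace.single 2 1))) x (R (EuclideanSpace.single 1 1)) ^ 2 + fderiv ℝ (fun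 x => inner ℝ (Literature.Analysis.FluidPDE.curl v x) (R (EuclideanSpace.single 2 1))) x (R (EuclideanSpace.single 2 1)) ^ 2)) - inner ℝ (v x) (R (EuclideanSpace.single 2 1)) * (ε ^ 2 / Real.sqrt (inner ℝ (Literature.Analysis.FluidPDE.curl v x) (R (EuclideanSpace.single 2 1)) ^ 2 + ε ^ 2) ^ 3) * (inner ℝ (Literature.Analysis.FluidPDE.curl v x) (R (EuclideanSpace.single 0 1)) * fderiv ℝ (fun x => inner ℝ (Literature.Analysis.FluidPDE.curl v x) (R (EuclideanSpace.single 2 1))) x (R (EuclideanSpace.single 0 1)) + inner ℝ (Literature.Analysis.FluidPDE.curl v x) (R (EuclideanSpace.single 1 1)) * fderiv ℝ (fun x => inner ℝ (Literature.Analysis.FluidPDE.curl v x) (R (EuclideanSpace.single 2 1))) x (R (EuclideanSpace.single 1 1))) - ε ^ 2 * (fderiv ℝ (fun x => inner ℝ (v x) (R (EuclideanSpace.single 2 1))) x (R (EuclideanSpace.single 2 1)) / Real.sqrt (inner ℝ (Literature.Analysis.FluidPDE.curl v x) (R (EuclideanSpace.single 2 1)) ^ 2 + ε ^ 2)) + fderiv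 ℝ (fun z => ν * fderiv ℝ (fun x => Real.sqrt (inner ℝ (Literature.Analysis.FluidPDE.curl v x) (R (EuclideanSpace.single 2 1)) ^ 2 + ε ^ 2)) z (R (EuclideanSpace.single 0 1)) - inner ℝ (v z) (R (EuclideanSpace.single 0 1)) * Real.sqrt (inner ℝ (Literature.Analysis.FluidPDE.curl v z) (R (EuclideanSpace.single 2 1)) ^ 2 + ε ^ 2) + inner ℝ (Literature.Analysis.FluidPDE.curl v z) (R (EuclideanSpace.single 2 1)) / Real.sqrt (inner ℝ (Literature.Analysis.FluidPDE.curl v z) (R (EuclideanSpace.single 2 1)) ^ 2 + ε ^ 2) * inner ℝ (v z) (R (EuclideanSpace.single 2 1)) * inner ℝ (Literature.Analysis.FluidPDE.curl v z) (R (EuclideanSpace.single 0 1))) x (R (EuclideanSpace.single 0 1)) + fderiv ℝ (fun z => ν * fderiv ℝ (fun x => Real.sqrt (inner ℝ (Literature.Analysis.FluidPDE.curl v x) (R (EuclideanSpace.single 2 1)) ^ 2 + ε ^ 2)) z (R (EuclideanSpace.single 1 1)) - inner ℝ (v z) (R (EuclideanSpace.single 1 1)) * Real.sqrt (inner ℝ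 (Literature.Analysis.FluidPDE.curl v z) (R (EuclideanSpace.single 2 1)) ^ 2 + ε ^ 2) + inner ℝ (Literature.Analysis.FluidPDE.curl v z) (R (EuclideanSpace.single 2 1)) / Real.sqrt (inner ℝ (Literature.Analysis.FluidPDE.curl v z) (R (EuclideanSpace.single 2 1)) ^ 2 + ε ^ 2) * inner ℝ (v z) (R (EuclideanSpace.single 2 1)) * inner ℝ (Literature.Analysis.FluidPDE.curl v z) (R (EuclideanSpace.single 1 1))) x (R (EuclideanSpace.single 1 1)) := by
  intro ν ε hε R v hv hdiv x
  -- smoothness of `v`, `ω = curl v`, `f = ⟪ω, n⟫`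
  have hv2 : ContDiff ℝ 2 v := contDiff_infty.1 hv 2
  have hω : ContDiff ℝ ∞ (curl v) := by
    rw [curl_eq_curlCLM_comp]
    exact curlCLM.contDiff.comp (hv.fderiv_right le_rfl)
  have hω2 : ContDiff ℝ 2 (curl v) := contDiff_infty.1 hω 2
  have hf2 : ContDiff ℝ 2 (fun x => ⟪curl v x, R (EuclideanSpace.single 2 1)⟫) := contDiff_inner_const hω2 _
  have hvd : ∀ z, DifferentiableAt ℝ v z := fun z => hv2.differentiable (by norm_num) z
  have hωd : ∀ z, DifferentiableAt ℝ (curl v) z := fun z => hω2.differentiable (by norm_num) z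
  -- the orthonormal frame `b = (R e₀, R e₁, R e₂)`
  set b : OrthonormalBasis (Fin 3) ℝ (EuclideanSpace ℝ (Fin 3)) :=
    (EuclideanSpace.basisFun (Fin 3) ℝ).map R with hb_def
  have hb : ∀ i, b i = R (EuclideanSpace.single i 1) := fun i => by
    rw [hb_def, OrthonormalBasis.map_apply, EuclideanSpace.basisFun_apply]
  -- `div v = 0` and `div ω = 0` in the frame `b`
  have hdivv : ⟪R (EuclideanSpace.single 0 1), fderiv ℝ v x (R (EuclideanSpace.single 0 1))⟫ + ⟪R (EuclideanSpace.single 1 1), fderiv ℝ v x (R (EuclideanSpace.single 1 1))⟫ +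
      ⟪R (EuclideanSpace.single 2 1), fderiv ℝ v x (R (EuclideanSpace.single 2 1))⟫ = 0 := by
    have h := hdiv x
    rw [divergence_eq_sum_inner_fderiv b, Fin.sum_univ_three, hb, hb, hb] at h
    exact h
  have hdivω : ⟪R (EuclideanSpace.single 0 1), fderiv ℝ (curl v) x (R (EuclideanSpace.single 0 1))⟫ + ⟪R (EuclideanSpace.single 1 1), fderiv ℝ (curl v) x (R (EuclideanSpace.single 1 1))⟫ +
      ⟪R (EuclideanSpace.single 2 1), fderiv ℝ (curl v) x (R (EuclideanSpace.single 2 1))⟫ = 0 := by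
    have h := divergence_curl_eq_zero_holds v hv2 x
    rw [divergence_eq_sum_inner_fderiv b, Fin.sum_univ_three, hb, hb, hb] at h
    exact h
  -- the Laplacian term: `⟪Δω, n⟫ = Δf = Σᵢ ∂ᵢ∂ᵢ f`
  have hlap : ⟪Laplacian.laplacian (curl v) x, R (EuclideanSpace.single 2 1)⟫ =
      fderiv ℝ (fderiv ℝ (fun x => ⟪curl v x, R (EuclideanSpace.single 2 1)⟫)) x (R (EuclideanSpace.single 0 1)) (R (EuclideanSpace.single 0 1)) +
      fderiv ℝ (fderiv ℝ (fun x => ⟪curl v x, R (EuclideanSpace.single 2 1)⟫)) x (R (EuclideanSpace.single 1 1)) (R (EuclideanSpace.single 1 1)) +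
      fderiv ℝ (fderiv ℝ (fun x => ⟪curl v x, R (EuclideanSpace.single 2 1)⟫)) x (R (EuclideanSpace.single 2 1)) (R (EuclideanSpace.single 2 1)) := by
    have h1 : ⟪Laplacian.laplacian (curl v) x, R (EuclideanSpace.single 2 1)⟫ =
        Laplacian.laplacian (⇑(innerSL ℝ (R (EuclideanSpace.single 2 1))) ∘ (curl v)) x := by
      rw [ContDiffAt.laplacian_CLM_comp_left hω2.contDiffAt, Function.comp_apply,
        innerSL_apply_apply, real_inner_comm]
    have h2 : (⇑(innerSL ℝ (R (EuclideanSpace.single 2 1))) ∘ (curl v)) = (fun x => ⟪curl v x, R (EuclideanSpace.single 2 1)⟫) := by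
      funext z
      rw [Function.comp_apply, innerSL_apply_apply, real_inner_comm]
    rw [h1, h2]
    simp only [InnerProductSpace.laplacian_eq_iteratedFDeriv_orthonormalBasis _ b,
      Fin.sum_univ_three, iteratedFDeriv_two_apply, Matrix.cons_val_zero, Matrix.cons_val_one, hb]
  -- the transport term: `⟪Dω(v), n⟫ = Σᵢ ⟪bᵢ, v⟫ ⟪Dω bᵢ, n⟫`
  have htr : ⟪fderiv ℝ (curl v) x (v x), R (EuclideanSpace.single 2 1)⟫ =
      ⟪R (EuclideanSpace.single 0 1), v x⟫ * ⟪fderiv ℝ (curl v) x (R (EuclideanSpace.single 0 1)), R (EuclideanSpace.single 2 1)⟫ +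
      ⟪R (EuclideanSpace.single 1 1), v x⟫ * ⟪fderiv ℝ (curl v) x (R (EuclideanSpace.single 1 1)), R (EuclideanSpace.single 2 1)⟫ +
      ⟪R (EuclideanSpace.single 2 1), v x⟫ * ⟪fderiv ℝ (curl v) x (R (EuclideanSpace.single 2 1)), R (EuclideanSpace.single 2 1)⟫ := by
    conv_lhs => rw [← b.sum_repr' (v x)]
    simp only [map_smul, map_add, inner_add_left, real_inner_smul_left, Fin.sum_univ_three, hb]
  -- the stretching term: `⟪Dv(ω), n⟫ = Σᵢ ⟪bᵢ, ω⟫ ⟪Dv bᵢ, n⟫`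
  have hst : ⟪fderiv ℝ v x (curl v x), R (EuclideanSpace.single 2 1)⟫ =
      ⟪R (EuclideanSpace.single 0 1), curl v x⟫ * ⟪fderiv ℝ v x (R (EuclideanSpace.single 0 1)), R (EuclideanSpace.single 2 1)⟫ +
      ⟪R (EuclideanSpace.single 1 1), curl v x⟫ * ⟪fderiv ℝ v x (R (EuclideanSpace.single 1 1)), R (EuclideanSpace.single 2 1)⟫ +
      ⟪R (EuclideanSpace.single 2 1), curl v x⟫ * ⟪fderiv ℝ v x (R (EuclideanSpace.single 2 1)), R (EuclideanSpace.single 2 1)⟫ := by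
    conv_lhs => rw [← b.sum_repr' (curl v x)]
    simp only [map_smul, map_add, inner_add_left, real_inner_smul_left, Fin.sum_univ_three, hb]
  -- expand the left-hand side and every derivative on the right-hand side
  simp only [convect_apply, inner_add_left, inner_sub_left, real_inner_smul_left]
  rw [hlap, htr, hst, fderiv_fderiv_sqrtReg_comp_apply hε hf2 x (R (EuclideanSpace.single 2 1)) (R (EuclideanSpace.single 2 1)),
    fderiv_foldFlux_apply hε ν hv2 hω2 (R (EuclideanSpace.single 2 1)) (R (EuclideanSpace.single 0 1)) (R (EuclideanSpace.single 0 1)) x,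
    fderiv_foldFlux_apply hε ν hv2 hω2 (R (EuclideanSpace.single 2 1)) (R (EuclideanSpace.single 1 1)) (R (EuclideanSpace.single 1 1)) x]
  simp only [fderiv_inner_const_apply (hωd x), fderiv_inner_const_apply (hvd x)]
  -- normal form of the scalar atoms: frame vector in the first slot
  simp only [real_inner_comm (R (EuclideanSpace.single 2 1)), real_inner_comm (R (EuclideanSpace.single 0 1)), real_inner_comm (R (EuclideanSpace.single 1 1))] at hdivv hdivω ⊢
  -- use `div v = 0`, `div ω = 0`
  rw [show ⟪R (EuclideanSpace.single 2 1), fderiv ℝ v x (R (EuclideanSpace.single 2 1))⟫ =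
      -⟪R (EuclideanSpace.single 0 1), fderiv ℝ v x (R (EuclideanSpace.single 0 1))⟫ - ⟪R (EuclideanSpace.single 1 1), fderiv ℝ v x (R (EuclideanSpace.single 1 1))⟫ by linarith,
    show ⟪R (EuclideanSpace.single 2 1), fderiv ℝ (curl v) x (R (EuclideanSpace.single 2 1))⟫ =
      -⟪R (EuclideanSpace.single 0 1), fderiv ℝ (curl v) x (R (EuclideanSpace.single 0 1))⟫ - ⟪R (EuclideanSpace.single 1 1), fderiv ℝ (curl v) x (R (EuclideanSpace.single 1 1))⟫ by linarith]
  -- `F² = f² + ε²`, and the rest is a rational identity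
  set Fx : ℝ := Real.sqrt (⟪R (EuclideanSpace.single 2 1), curl v x⟫ ^ 2 + ε ^ 2) with hFx
  have hFx0 : Fx ≠ 0 := (sqrt_sq_add_sq_pos hε _).ne'
  have hε2 : ε ^ 2 = Fx ^ 2 - ⟪R (EuclideanSpace.single 2 1), curl v x⟫ ^ 2 := by rw [hFx, sqrtReg_sq]; ring
  rw [hε2]
  field_simp
  ring

end Summit.NavierStokesRegularity.NavierStokesRegularity.Theorems.SlicedKelvinPlanarFluxAPriori

end
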